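import Mathlib
import Summits.NavierStokesRegularity.NavierStokesRegularity.Theorems.EulerZoomLiouvillePowerGaugeEulerLiouvilleDSSFiniteNodesMember
import Summits.NavierStokesRegularity.NavierStokesRegularity.Theorems.EulerZoomLiouvillePowerGaugeEulerLiouvilleDSSNodeClusterConnected
import HarnessLib.Audit

/-!
# Crux E `PowerGaugeEulerLiouville` (stmt-NavierStokesRegularity-19832): THE DSS BERNOULLI-CLOCKED STRATUM WITH COUNTABLY MANY PERMANENT NODES
# (width seat ns-cas-k2 g3, lane «DSS thin vortical nodes», tool C part 6 — drop-in widening of the wired `…finiteNodes` member)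

Route `EulerZoomLiouville` (NavierStokesRegularity), crux E.  The LEAD's skeleton v67 dispatches the 7th alternative of `IsDSSClassicalTame` to
`DSSNodes.ae_eq_zero_of_gauge_of_dss_of_clock_finiteNodes` (…DSSFiniteNodesMember).  With the connected-cluster-set upgrade (…DSSNodeClusterConnected,
`exists_tendsto_lattice_of_countable_nodes`) the finiteness binder can be relaxed to COUNTABILITY, all other binders verbatim:
* `dss_curl_eq_zero_or_tendsto_vorticalNode_countable` — trajectory-level dichotomy with countably many permanent nodes in the ball;
* **`ae_eq_zero_of_gauge_of_dss_of_clock_countableNodes`** — MEMBER: binders of `…finiteNodes` with `hfin : ∀ R, {…}.Finite` replaced by `hcount : ∀ R, {…}.Countable`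
  (the confined vortical set at each `τ₀` lies in the countable union of the null basins of the vortical permanent nodes).

WHAT THIS IS NOT: not NS regularity, not the crux E — a stratum of hypothetical DSS blow-up members; 19832 is OPEN. [folklore]
-/

noncomputable section

set_option linter.dupNamespace false

open MeasureTheory Set Filter Topology Metric Function
open scoped NNReal ENNReal ContDiff InnerProductSpace RealInnerProductSpace

namespace Summit.NavierStokesRegularity.NavierStokesRegularity.Theorems.PowerGaugeEulerLiouville.DSSNodes

open Literature.Analysis Literature.Analysis.FluidPDE Literature.Analysis.FunctionSpaces
open Summit.NavierStokesRegularity.NavierStokesRegularity.Theorems.PowerGaugeEulerLiouville.SimilarityBernoulli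
open Summit.NavierStokesRegularity.NavierStokesRegularity.Theorems.PowerGaugeEulerLiouville.VorticityBirth
open Summit.NavierStokesRegularity.NavierStokesRegularity.Theorems.PowerGaugeEulerLiouville.MovingSpherePiercing

variable {u : ℝ → EuclideanSpace ℝ (Fin 3) → EuclideanSpace ℝ (Fin 3)} {p : ℝ → EuclideanSpace ℝ (Fin 3) → ℝ} {θ ρ l : ℝ}

/-! ### The dichotomy with countably many nodes -/

/-- **DICHOTOMY, COUNTABLE FORM.**  Tame-clocked `l`-DSS member (global Type-I `K`, pressure clock `θ < 1`, pressure bounds on the moving ball `R`), the permanent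
nodes of the ball `‖y‖ ≤ R` COUNTABLE, the full stretching form `≤ κ < 1` at its NON-vortical permanent nodes.  Then a backward trajectory confined to the
moving ball either carries no vorticity at `τ₀`, or converges along the phase lattice to a VORTICAL permanent node of the ball (`exists_tendsto_lattice_of_countable_nodes`).
[folklore] -/
theorem dss_curl_eq_zero_or_tendsto_vorticalNode_countable (hcl : IsClassicalEulerSolutionOn (Iio 0) 0 u p) (hρ : 0 < ρ) (hl : 1 < l)
    (hdss : ∀ τ : ℝ, τ < 0 → ∀ y, u τ y = (l ^ (1 + ρ)) • u ((l ^ (2 + ρ)) * τ) (l • y))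
    {K : ℝ} (hK : ∀ s : ℝ, s < 0 → ∀ y : EuclideanSpace ℝ (Fin 3),
      (-s) * ‖fderiv ℝ (u s) y‖ ≤ K ∧ (-s) ^ (1 - (2 + ρ)⁻¹) * ‖u s y‖ ≤ K)
    (hθ : θ < 1)
    (hclock : ∀ s : ℝ, s < 0 → ∀ x : EuclideanSpace ℝ (Fin 3),
      (-s) * timeDerivWithin (Iio 0) p s x - (2 + ρ)⁻¹ * fderiv ℝ (p s) x x - 2 * (1 - (2 + ρ)⁻¹) * p s x ≤
        θ * (1 - 2 * (2 + ρ)⁻¹) * ‖u s x + ((2 + ρ)⁻¹ / (-s)) • x‖ ^ 2)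
    {R P₀ G κ : ℝ} (hκ : κ < 1)
    (hP₀ : ∀ s : ℝ, s < 0 → ∀ x : EuclideanSpace ℝ (Fin 3), ‖x‖ ≤ R * (-s) ^ (2 + ρ)⁻¹ →
      (-s) ^ (2 - 2 * (2 + ρ)⁻¹) * p s x ≤ P₀)
    (hG : ∀ s : ℝ, s < 0 → ∀ x : EuclideanSpace ℝ (Fin 3), ‖x‖ ≤ R * (-s) ^ (2 + ρ)⁻¹ →
      (-s) ^ (2 - (2 + ρ)⁻¹) * ‖gradient (p s) x‖ ≤ G)
    (hcount : {y : EuclideanSpace ℝ (Fin 3) | ‖y‖ ≤ R ∧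
      ∀ t : ℝ, t < 0 → u t ((-t) ^ (2 + ρ)⁻¹ • y) = (-((2 + ρ)⁻¹ * (-t) ^ ((2 + ρ)⁻¹ - 1))) • y}.Countable)
    (hnode0 : ∀ y : EuclideanSpace ℝ (Fin 3), ‖y‖ ≤ R →
      (∀ t : ℝ, t < 0 → u t ((-t) ^ (2 + ρ)⁻¹ • y) = (-((2 + ρ)⁻¹ * (-t) ^ ((2 + ρ)⁻¹ - 1))) • y) →
      (∀ t : ℝ, t < 0 → curl (u t) ((-t) ^ (2 + ρ)⁻¹ • y) = 0) → ∀ t : ℝ, t < 0 → ∀ v : EuclideanSpace ℝ (Fin 3),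
        (-t) * ⟪fderiv ℝ (u t) ((-t) ^ (2 + ρ)⁻¹ • y) v, v⟫ ≤ κ * ‖v‖ ^ 2)
    {τ₀ : ℝ} (hτ₀ : τ₀ < 0) {x₀ : EuclideanSpace ℝ (Fin 3)}
    (hconf : ∀ s : ℝ, s ≤ τ₀ → ‖ODE.evolutionMap u τ₀ s x₀‖ ≤ R * (-s) ^ (2 + ρ)⁻¹) :
    curl (u τ₀) x₀ = 0 ∨ ∃ ys : EuclideanSpace ℝ (Fin 3), ‖ys‖ ≤ R ∧
      (∀ t : ℝ, t < 0 → u t ((-t) ^ (2 + ρ)⁻¹ • ys) = (-((2 + ρ)⁻¹ * (-t) ^ ((2 + ρ)⁻¹ - 1))) • ys) ∧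
      curl (u τ₀) ((-τ₀) ^ (2 + ρ)⁻¹ • ys) ≠ 0 ∧
      Tendsto (fun j : ℕ => (l ^ j)⁻¹ • ODE.evolutionMap u τ₀ ((l ^ (2 + ρ)) ^ j * τ₀) x₀) atTop
        (𝓝 ((-τ₀) ^ (2 + ρ)⁻¹ • ys)) := by
  have hρ2 : 0 < 2 + ρ := by linarith
  have hl0 : 0 < l := zero_lt_one.trans hl
  set n : ℝ := (2 + ρ)⁻¹ with hn
  have hn0 : 0 ≤ n := (inv_pos.2 hρ2).le
  have hn2 : n < 1 / 2 := by
    rw [hn, inv_lt_comm₀ hρ2 (by norm_num)]; norm_num; linarith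
  have hΛc : ContinuousOn (fun s : ℝ => K / (-s)) (Iio 0) :=
    continuousOn_const.div continuousOn_neg fun s hs => by rw [mem_Iio] at hs; linarith
  have hΛ : ∀ s : ℝ, s < 0 → ∀ y, ‖fderiv ℝ (u s) y‖ ≤ K / (-s) := fun s hs y => by
    rw [le_div_iff₀ (by linarith), mul_comm]; exact (hK s hs y).1
  have hlip : ODE.IsUniformlyLipschitzOn u (Iio 0) := isUniformlyLipschitzOn hcl hΛc hΛ
  set X : ℝ → EuclideanSpace ℝ (Fin 3) := fun s => ODE.evolutionMap u τ₀ s x₀ with hX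
  have hXd : ∀ s : ℝ, s < 0 → HasDerivAt X (u s (X s)) s := fun s hs =>
    hlip.hasDerivAt_evolutionMap (convex_Iio 0) hτ₀ (Iio_mem_nhds hs) x₀
  have hconf' : ∀ s : ℝ, s ≤ τ₀ → ‖X s‖ ≤ R * (-s) ^ n := hconf
  have hrest := tendsto_similaritySpeed_zero_of_clock hcl hn0 hn2 hθ hclock hτ₀ hXd hconf'
    (fun s hs => (hK s (by linarith) (X s)).2) (fun s hs => hP₀ s (by linarith) (X s) (hconf' s hs))
    (fun s hs => hG s (by linarith) (X s) (hconf' s hs))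
  obtain ⟨ys, hysR, hysN, hlat⟩ := exists_tendsto_lattice_of_countable_nodes hcl hl hρ2 hdss hXd hrest hτ₀ hconf' hcount
  by_cases hv : curl (u τ₀) ((-τ₀) ^ n • ys) = 0
  · -- non-vortical node: subcritical at every phase, the trajectory is eventually subcritical, the vorticity dies
    left
    have hall : ∀ t : ℝ, t < 0 → curl (u t) ((-t) ^ n • ys) = 0 := fun t ht =>
      curl_node_eq_zero_of_phase hcl hlip hysN hτ₀ hv ht
    have hκ' : κ < (1 + κ) / 2 := by linarith
    obtain ⟨σ₁, hσ₁τ, hsub⟩ := eventually_subcritical_of_tendsto_node hcl hl hρ2 hdss hκ' hτ₀ hXd hrest hlat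
      (hnode0 ys hysR hysN hall)
    have hC : ∀ s : ℝ, s ≤ σ₁ → (-s) * ‖curl (u s) (ODE.evolutionMap u τ₀ s x₀)‖ ≤ 4 * K := by
      intro s hs
      have hs0 : 0 < -s := by linarith [hs.trans hσ₁τ]
      have h1 := norm_curl_le_four_mul (u s) (X s)
      have h2 := (hK s (by linarith) (X s)).1
      calc (-s) * ‖curl (u s) (X s)‖ ≤ (-s) * (4 * ‖fderiv ℝ (u s) (X s)‖) := mul_le_mul_of_nonneg_left h1 hs0.le
        _ = 4 * ((-s) * ‖fderiv ℝ (u s) (X s)‖) := by ring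
        _ ≤ 4 * K := by linarith
    exact curl_eq_zero_of_eventually_subcritical hcl hΛc hΛ hτ₀ hσ₁τ (by linarith : (1 + κ) / 2 < 1) hsub hC
  · -- vortical node: the trajectory converges to it along the phase lattice
    right
    refine ⟨ys, hysR, hysN, hv, ?_⟩
    have hc := hlat.const_smul ((-τ₀) ^ n)
    refine hc.congr fun j => ?_
    simp only [hX]
    have hTj : (l ^ (2 + ρ)) ^ j * τ₀ < 0 := mul_neg_of_pos_of_neg (pow_pos (Real.rpow_pos_of_pos hl0 _) _) hτ₀
    have hp : 0 < (-((l ^ (2 + ρ)) ^ j * τ₀)) ^ n := Real.rpow_pos_of_pos (by linarith) _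
    rw [smul_smul, Real.rpow_neg (by linarith) n, ← pow_mul_rpow_eq hl hρ2 j hτ₀, mul_inv,
      show (-τ₀) ^ n * ((l ^ j)⁻¹ * ((-τ₀) ^ n)⁻¹) = (l ^ j)⁻¹ by
        field_simp [(Real.rpow_pos_of_pos (by linarith : (0:ℝ) < -τ₀) n).ne']]

/-! ### The member theorem, countable form -/

/-- **TAME DSS MEMBERS WITH A SUB-BERNOULLI PRESSURE CLOCK, COUNTABLY MANY PERMANENT NODES PER BALL AND SUBCRITICAL NON-VORTICAL NODES ARE TRIVIAL.**  Crux
hypotheses verbatim (every `ρ > 0`) + classical + `u(τ,y) = l^{1+ρ}u(l^{2+ρ}τ, ly)`, `p(τ,y) = l^{2+2ρ}p(l^{2+ρ}τ, ly)` (`l > 1`) + tame + pressure clock (`θ < 1`) + for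
every ball `‖y‖ ≤ R`: its permanent nodes are COUNTABLY MANY and a constant `κ < 1` bounds the full stretching form at the NON-VORTICAL ones (those whose self-similar
path carries no vorticity) ⇒ `u = 0` a.e.  Nothing is asked at VORTICAL permanent nodes: their backward basins are null (`volume_setOf_tendsto_vorticalNode_eq_zero`).
[folklore] -/
theorem ae_eq_zero_of_gauge_of_dss_of_clock_countableNodes (hρ : 0 < ρ)
    {H : ℝ → EuclideanSpace ℝ (Fin 3) → EuclideanSpace ℝ (Fin 3) →L[ℝ] EuclideanSpace ℝ (Fin 3)} {c₀ : ℝ≥0}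
    (hsw : IsSuitableWeakSolutionOn (slab (EuclideanSpace ℝ (Fin 3)) (Iio 0) isOpen_Iio) 0 0 u p)
    (hH : HasWeakSpatialGradientOn (slab (EuclideanSpace ℝ (Fin 3)) (Iio 0) isOpen_Iio) u H)
    (hgauge : ∀ a : ℝ, 0 < a →
      ENNReal.ofReal (a ^ (2 * ρ)) * cknA a (0 : ℝ × EuclideanSpace ℝ (Fin 3)) u +
          ENNReal.ofReal (a ^ ρ) * cknE a (0 : ℝ × EuclideanSpace ℝ (Fin 3)) H +
        ENNReal.ofReal (a ^ (2 * ρ)) * cknD a (0 : ℝ × EuclideanSpace ℝ (Fin 3)) p ≤ (c₀ : ℝ≥0∞))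
    (hcl : IsClassicalEulerSolutionOn (Iio 0) 0 u p) (hl : 1 < l)
    (hdss : ∀ τ : ℝ, τ < 0 → ∀ y, u τ y = (l ^ (1 + ρ)) • u ((l ^ (2 + ρ)) * τ) (l • y))
    (hpdss : ∀ τ : ℝ, τ < 0 → ∀ y, p τ y = l ^ (2 + 2 * ρ) * p ((l ^ (2 + ρ)) * τ) (l • y))
    (htame : ∀ s t : ℝ, s < t → t < 0 → ∃ B : ℝ, ∀ τ ∈ Icc s t, ∀ y : EuclideanSpace ℝ (Fin 3),
      ‖u τ y‖ ≤ B ∧ ‖fderiv ℝ (u τ) y‖ ≤ B)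
    (hθ : θ < 1)
    (hclock : ∀ s : ℝ, s < 0 → ∀ x : EuclideanSpace ℝ (Fin 3),
      (-s) * timeDerivWithin (Iio 0) p s x - (2 + ρ)⁻¹ * fderiv ℝ (p s) x x - 2 * (1 - (2 + ρ)⁻¹) * p s x ≤
        θ * (1 - 2 * (2 + ρ)⁻¹) * ‖u s x + ((2 + ρ)⁻¹ / (-s)) • x‖ ^ 2)
    (hcount : ∀ R : ℝ, {y : EuclideanSpace ℝ (Fin 3) | ‖y‖ ≤ R ∧
      ∀ t : ℝ, t < 0 → u t ((-t) ^ (2 + ρ)⁻¹ • y) = (-((2 + ρ)⁻¹ * (-t) ^ ((2 + ρ)⁻¹ - 1))) • y}.Countable)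
    (hnodes : ∀ R : ℝ, 0 < R → ∃ κ : ℝ, κ < 1 ∧
      ∀ y : EuclideanSpace ℝ (Fin 3), ‖y‖ ≤ R →
        (∀ t : ℝ, t < 0 → u t ((-t) ^ (2 + ρ)⁻¹ • y) = (-((2 + ρ)⁻¹ * (-t) ^ ((2 + ρ)⁻¹ - 1))) • y) →
        (∀ t : ℝ, t < 0 → curl (u t) ((-t) ^ (2 + ρ)⁻¹ • y) = 0) → ∀ t : ℝ, t < 0 → ∀ v : EuclideanSpace ℝ (Fin 3),
          (-t) * ⟪fderiv ℝ (u t) ((-t) ^ (2 + ρ)⁻¹ • y) v, v⟫ ≤ κ * ‖v‖ ^ 2) :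
    uncurry u =ᵐ[volume.restrict (Iio (0 : ℝ) ×ˢ (univ : Set (EuclideanSpace ℝ (Fin 3))))] 0 := by
  -- as `ae_eq_zero_of_gauge_of_dss_of_clock_finiteNodes`, with a countable union of null basins
  have hρ2 : 0 < 2 + ρ := by linarith
  have hl0 : 0 < l := zero_lt_one.trans hl
  have hn0 : 0 < (2 + ρ)⁻¹ := inv_pos.2 hρ2
  obtain ⟨B, hB⟩ := htame (-(l ^ (2 + ρ))) (-1) (by linarith [Real.one_lt_rpow hl hρ2]) (by norm_num)
  have hK := exists_typeI_of_dss_tame hl hρ2 (by linarith) hdss hB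
  set K : ℝ := l ^ (2 + ρ) * B with hKdef
  have hΛc : ContinuousOn (fun s : ℝ => K / (-s)) (Iio 0) :=
    continuousOn_const.div continuousOn_neg fun s hs => by rw [mem_Iio] at hs; linarith
  have hΛ : ∀ s : ℝ, s < 0 → ∀ y, ‖fderiv ℝ (u s) y‖ ≤ K / (-s) := fun s hs y => by
    rw [le_div_iff₀ (by linarith), mul_comm]; exact (hK s hs y).1
  have hlip : ODE.IsUniformlyLipschitzOn u (Iio 0) := isUniformlyLipschitzOn hcl hΛc hΛ
  refine ae_eq_zero_of_gauge_of_piercing_of_confinedNull_allRho (n := (2 + ρ)⁻¹) hρ hsw hH hgauge hcl hΛc hΛ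
    (fun R₀ => ?_) (fun τ₀ hτ₀ R hR => ?_)
  · set R : ℝ := max R₀ (K / (2 + ρ)⁻¹ + 1) with hRdef
    have hbR : K < (2 + ρ)⁻¹ * R := by
      have h1 : K / (2 + ρ)⁻¹ + 1 ≤ R := le_max_right _ _
      have h2 : K / (2 + ρ)⁻¹ < R := by linarith
      rwa [div_lt_iff₀ hn0, mul_comm] at h2
    exact ⟨R, le_max_left _ _, fun σ hσ x hx hfast =>
      absurd hfast (not_le.2 (noFastInflow_of_boundedSpeed hσ hbR (fun y _ => (hK σ hσ y).2) hx))⟩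
  · obtain ⟨P₀, G, hPG⟩ := exists_pressure_core_bounds_of_dss hcl.smooth_pressure hl hρ2 hpdss R
    obtain ⟨κ, hκ, hnode0⟩ := hnodes R hR
    -- the confined vortical set lies in the union of the null basins of the vortical permanent nodes of the ball
    set N : Set (EuclideanSpace ℝ (Fin 3)) := {y | ‖y‖ ≤ R ∧
      ∀ t : ℝ, t < 0 → u t ((-t) ^ (2 + ρ)⁻¹ • y) = (-((2 + ρ)⁻¹ * (-t) ^ ((2 + ρ)⁻¹ - 1))) • y} with hNdef
    have hsub : {x : EuclideanSpace ℝ (Fin 3) | curl (u τ₀) x ≠ 0 ∧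
        ∀ σ : ℝ, σ ≤ τ₀ → ‖ODE.evolutionMap u τ₀ σ x‖ < R * (-σ) ^ (2 + ρ)⁻¹} ⊆
        ⋃ ys ∈ N, {x : EuclideanSpace ℝ (Fin 3) | curl (u τ₀) ((-τ₀) ^ (2 + ρ)⁻¹ • ys) ≠ 0 ∧
          Tendsto (fun j : ℕ => (l ^ j)⁻¹ • ODE.evolutionMap u τ₀ ((l ^ (2 + ρ)) ^ j * τ₀) x) atTop
            (𝓝 ((-τ₀) ^ (2 + ρ)⁻¹ • ys))} := by
      intro x hx
      rcases dss_curl_eq_zero_or_tendsto_vorticalNode_countable hcl hρ hl hdss hK hθ hclock hκ (fun s hs y hy => (hPG s hs y hy).1)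
          (fun s hs y hy => (hPG s hs y hy).2) (hcount R) hnode0 hτ₀ (fun s hs => (hx.2 s hs).le) with h0 | ⟨ys, hysR, hysN, hv, ht⟩
      · exact absurd h0 hx.1
      · exact mem_biUnion (show ys ∈ N from ⟨hysR, hysN⟩) ⟨hv, ht⟩
    refine measure_mono_null hsub ((measure_biUnion_null_iff (hcount R)).2 fun ys hys => ?_)
    by_cases hv : curl (u τ₀) ((-τ₀) ^ (2 + ρ)⁻¹ • ys) = 0
    · have : {x : EuclideanSpace ℝ (Fin 3) | curl (u τ₀) ((-τ₀) ^ (2 + ρ)⁻¹ • ys) ≠ 0 ∧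
          Tendsto (fun j : ℕ => (l ^ j)⁻¹ • ODE.evolutionMap u τ₀ ((l ^ (2 + ρ)) ^ j * τ₀) x) atTop
            (𝓝 ((-τ₀) ^ (2 + ρ)⁻¹ • ys))} = ∅ :=
        eq_empty_iff_forall_notMem.2 fun x hx => hx.1 hv
      rw [this, measure_empty]
    · refine measure_mono_null (fun x hx => hx.2) ?_
      exact volume_setOf_tendsto_vorticalNode_eq_zero hcl hlip hl hρ hdss hys.2 hτ₀ hv

end Summit.NavierStokesRegularity.NavierStokesRegularity.Theorems.PowerGaugeEulerLiouville.DSSNodes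

end
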